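import Summits.QuantumFields.YangMills.Theorems.UnitScaleTiltProp7CovKernelOneStep
import Summits.QuantumFields.YangMills.Theorems.UnitScaleTiltProp7TwistedOneStepDefectCovGauge
import Summits.QuantumFields.YangMills.Theorems.UnitScaleTiltProp7TrueLinDefectBound
import HarnessLib

/-!
# Route `UnitScaleTilt`, crux K1 «MinimiserStabilityRegPr» (stmt-QuantumFields-19200), EX display row (157)-twˢ `hC157`, C-ENTRY line, file F-3b —
# **THE SIZES OF THE ORBIT OF THE COVARIANT LOG-COORDINATE TOWER: `‖x_m‖ ≤ 2·Lᵐ·‖B‖`**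
# ([Balaban1985Averaging] (131) p.37 ∕ (149)–(150) p.40: the field at level `m` measured in level-`m` units grows by `L` per step; here for the CURVED one-step charts
# `f_l(y)(c) = log[U̿(Ū₀ˡ; e^{y}Ū₀ˡ)(c)·Ū₀^{l+1}(c)⁻¹]` of the tower of a plaquette-small SU(2) background, WITHOUT the background-curvature garbage of the frame-comparison windows)

Cell `ym3-torus` (HUMAN RULING D-0037: YM₃ on T³ is ladder rung R3, not the Clay problem), width seat `ym3-torus-px18` gen 3; ★w2-19200 g8 «C-ENTRY GO».  `--supports
stmt-QuantumFields-19200 --as helper`; def-free, 0 sorry; count-neutral.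

§1 (Mathlib-only) ★ `orbit_growth_le` — THE ABSTRACT GROWTH LEMMA: a real sequence `ξ` with `ξ₀ ≤ β` and `ξ_{m+1} ≤ (Λ + κ_m + D_m·ξ_m)·ξ_m` whenever `ξ_m ≤ σ` (`m < J`), with
`0 < Λ`, `κ, D ≥ 0`, the domain condition `2Λᵐβ ≤ σ` (`m < J`) and the summability `Σ_{m<J} (κ_m + D_m·2Λᵐβ) ≤ Λ/2`, satisfies `ξ_m ≤ 2Λᵐβ` for all `m ≤ J`
(invariant `ξ_m ≤ Λᵐ(1 + (2/Λ)Σ_{l<m}(κ_l + D_l·2Λˡβ))β`, `(1+δ)(1+2S) ≤ 1+2(S+δ)` for `2S ≤ 1`).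
§2 (SU(2), `PlaqSmall a₀ U₀`, the tower `Ū₀ˡ = emlIterU l U₀♭`, ★routeR-w6's cluster axial gauges and budgets VERBATIM, `s₀(l) = 30ℓLˡ·2d(3L^{l+1} − 1)a₀`):
`norm_chart_apply_le_of_plaqSmall` — THE ONE-STEP GROWTH `‖f_l(y)(c)‖ ≤ (L + c_R(l) + D(l,R)·2dLᵈ·‖y‖)·‖y‖` for `2‖y‖ < R` (F-2 ✓`Prop7CovKernelOneStep.norm_fderiv_chart_le_mul_sup` +
★routeR-w6 ✓`norm_chart_sub_fderiv_le_localMass_of_plaqSmall` + ✓`Prop7TrueLinDefectBound.card_nbhd_le`), `c_R(l) := 16(12Lρ)∕ρ²·(2s₀(l))`,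
`D(l,R) := 80(L·3R + 22100ℓ²(s₀(l)+(s₀(l)+3R))²)∕R²`; ★★★ `norm_iterate_le_of_plaqSmall` — for the iterate `Fm` of F0″-b (✓`Prop7CovLogTower.exists_iterate` letters: `Fm 0 x = x`,
`Fm (l+1) x = f_l(Fm l x)`), `J + 1 ≤ m_P + K_P`, the budgets for all `l < J`, `4L^J‖B‖ < R`, `Σ_{l<J} c_R(l) ≤ L/4`, `Σ_{l<J} D(l,R)·2dLᵈ·2Lˡ‖B‖ ≤ L/4`:
**`‖Fm m B‖ ≤ 2·Lᵐ·‖B‖` for every `m ≤ J`** — the sizes `s_m` (`L·s_m ≤ s_{m+1}` EXACT) of ✓`ChartKernelTower.kernel_tower_bound_le` at a curved background.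
HONEST SCOPE.  Bookkeeping over landed bricks; the two summability windows are DISPLAYED (the T³ reading discharges them from the geometric `s₀(l)` and `Lˡ ≤ L^J`); nothing of
`hC157`, EX, E′ or the crux is claimed; rung R3, not d = 4; YM gap NOT proved.

References: T. Bałaban, CMP **98** (1985) 17–51 [Balaban1985Averaging] ((89) p.31, (121)–(127) p.36, (131) p.37, (139) p.39, (149)–(152) p.40, (161)–(163) p.42).
-/

noncomputable section

open scoped BigOperators
open NormedSpace Metric Set Finset

namespace Summit.QuantumFields.YangMills.Theorems.Prop7CovOrbitSizes

/-! ## §1 The abstract growth lemma -/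

section Abstract

/-- `(1 + δ)(1 + 2S) ≤ 1 + 2(S + δ)` for `0 ≤ δ`, `2S ≤ 1`. [folklore] -/
theorem one_add_mul_one_add_two_mul_le {δ S : ℝ} (hδ : 0 ≤ δ) (hS : 2 * S ≤ 1) : (1 + δ) * (1 + 2 * S) ≤ 1 + 2 * (S + δ) := by
  nlinarith

/-- ★ **THE ABSTRACT GROWTH LEMMA** (`ξ_{m+1} ≤ (Λ + κ_m + D_mξ_m)ξ_m` on `ξ_m ≤ σ`; domain `2Λᵐβ ≤ σ`, summability `Σ_{m<J}(κ_m + D_m·2Λᵐβ) ≤ Λ/2` ⇒ `ξ_m ≤ 2Λᵐβ`, `m ≤ J`).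
[cite: Balaban1985Averaging, (131) p.37, (149)-(150) p.40] -/
theorem orbit_growth_le (J : ℕ) (ξ κ D : ℕ → ℝ) {Λ β σ : ℝ} (hΛ : 0 < Λ) (hβ : 0 ≤ β) (hκ : ∀ m, m < J → 0 ≤ κ m) (hD : ∀ m, m < J → 0 ≤ D m)
    (hξ0 : ∀ m, m ≤ J → 0 ≤ ξ m) (h0 : ξ 0 ≤ β)
    (hstep : ∀ m, m < J → ξ m ≤ σ → ξ (m + 1) ≤ (Λ + κ m + D m * ξ m) * ξ m)
    (hdom : ∀ m, m < J → 2 * Λ ^ m * β ≤ σ)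
    (hsum : ∑ m ∈ Finset.range J, (κ m + D m * (2 * Λ ^ m * β)) ≤ Λ / 2) :
    ∀ m, m ≤ J → ξ m ≤ 2 * Λ ^ m * β := by
  -- the invariant with the partial sums
  have hδnn : ∀ m, m < J → 0 ≤ (κ m + D m * (2 * Λ ^ m * β)) / Λ := fun m hm =>
    div_nonneg (add_nonneg (hκ m hm) (mul_nonneg (hD m hm) (by positivity))) hΛ.le
  have hSle : ∀ m, m ≤ J → 2 * ∑ l ∈ Finset.range m, (κ l + D l * (2 * Λ ^ l * β)) / Λ ≤ 1 := by
    intro m hm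
    have hmono : ∑ l ∈ Finset.range m, (κ l + D l * (2 * Λ ^ l * β)) / Λ ≤ ∑ l ∈ Finset.range J, (κ l + D l * (2 * Λ ^ l * β)) / Λ :=
      Finset.sum_le_sum_of_subset_of_nonneg (Finset.range_mono hm) fun l hl _ => hδnn l (Finset.mem_range.1 hl)
    have hJ : ∑ l ∈ Finset.range J, (κ l + D l * (2 * Λ ^ l * β)) / Λ ≤ 1 / 2 := by
      rw [← Finset.sum_div, div_le_iff₀ hΛ]; linarith
    linarith
  have hinv : ∀ m, m ≤ J → ξ m ≤ Λ ^ m * (1 + 2 * ∑ l ∈ Finset.range m, (κ l + D l * (2 * Λ ^ l * β)) / Λ) * β := by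
    intro m
    induction m with
    | zero => intro _; simpa using h0
    | succ m ih =>
      intro hm
      have hm' : m < J := Nat.lt_of_succ_le hm
      have hprev := ih hm'.le
      set S : ℝ := ∑ l ∈ Finset.range m, (κ l + D l * (2 * Λ ^ l * β)) / Λ with hS
      have hS1 : 2 * S ≤ 1 := hSle m hm'.le
      have hS0 : 0 ≤ S := Finset.sum_nonneg fun l hl => hδnn l ((Finset.mem_range.1 hl).trans hm')
      -- the a-priori bound `ξ m ≤ 2Λ^m β`, hence the domain condition
      have h2 : ξ m ≤ 2 * Λ ^ m * β := by
        refine hprev.trans ?_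
        have : Λ ^ m * (1 + 2 * S) * β ≤ Λ ^ m * 2 * β := by
          have hΛm : 0 ≤ Λ ^ m := by positivity
          nlinarith [mul_nonneg hΛm hβ]
        linarith
      have hσ : ξ m ≤ σ := h2.trans (hdom m hm')
      have hst := hstep m hm' hσ
      set δ : ℝ := (κ m + D m * (2 * Λ ^ m * β)) / Λ with hδ
      have hδ0 : 0 ≤ δ := hδnn m hm'
      -- the growth factor is at most `Λ(1 + δ)`
      have hfac : Λ + κ m + D m * ξ m ≤ Λ * (1 + δ) := by
        have hΛδ : Λ * δ = κ m + D m * (2 * Λ ^ m * β) := by rw [hδ]; field_simp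
        nlinarith [mul_le_mul_of_nonneg_left h2 (hD m hm')]
      have hsucc : ∑ l ∈ Finset.range (m + 1), (κ l + D l * (2 * Λ ^ l * β)) / Λ = S + δ := by rw [Finset.sum_range_succ]
      rw [hsucc]
      calc ξ (m + 1) ≤ (Λ + κ m + D m * ξ m) * ξ m := hst
        _ ≤ Λ * (1 + δ) * (Λ ^ m * (1 + 2 * S) * β) :=
            mul_le_mul hfac hprev (hξ0 m hm'.le) (by positivity)
        _ = Λ ^ (m + 1) * ((1 + δ) * (1 + 2 * S)) * β := by ring
        _ ≤ Λ ^ (m + 1) * (1 + 2 * (S + δ)) * β := by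
            have hΛm : 0 ≤ Λ ^ (m + 1) := by positivity
            have := one_add_mul_one_add_two_mul_le hδ0 hS1
            exact mul_le_mul_of_nonneg_right (mul_le_mul_of_nonneg_left this hΛm) hβ
  intro m hm
  refine (hinv m hm).trans ?_
  have hS1 := hSle m hm
  have hΛm : 0 ≤ Λ ^ m := by positivity
  nlinarith [mul_nonneg hΛm hβ]

end Abstract

/-! ## §2 The one-step growth and the orbit sizes for the tower of a plaquette-small SU(2) background -/

section SU2

open scoped Matrix.Norms.L2Operator
open Literature.MathematicalPhysics.QuantumFieldTheory.Balaban1983to89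
open T4Continuum BlockAveraging AveragingRT ExpMeanLog
open B15DeterminingSets (embIter)
open B7Prop1Explicit (expUnit val_expUnit U1 mem_U1)
open MatrixLog (mlog)
open B10Eq27TorusAxialLog (axialT gaugeActT gaugeActT_apply unitsField toUField suIncl)
open Summit.QuantumFields.YangMills.Theorems.Prop8Chart (emlAvgU emlIterU)
open Summit.QuantumFields.YangMills.Theorems.Prop7SymAvgTwSym (dbarCovU)
open Summit.QuantumFields.YangMills.Theorems.Prop7TwistedOneStepDefectCovGauge (transfUp_toUnits_mem_U1 norm_bgTower_gauged_sub_one_le_of_plaqSmall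
  norm_chart_sub_fderiv_le_localMass_of_plaqSmall)
open Summit.QuantumFields.YangMills.Theorems.Prop7TwistedOneStepLinL1OfPlaqSmall (norm_transfUp_toUnits_le_one)
open Summit.QuantumFields.YangMills.Theorems.Prop7CovKernelOneStep (norm_fderiv_chart_le_mul_sup)
open Summit.QuantumFields.YangMills.Theorems.Prop7TrueLinDefectBound (card_nbhd_le)

variable {P : Params}

/-- ★ **THE ONE-STEP GROWTH AT LEVEL `l`** (`V := Ū₀ˡ`, `PlaqSmall a₀ U₀`, cluster axial gauge at `c₋`, budgets `6400ℓ²Lˡs_B ≤ 1`, `10⁷ℓ²ρ ≤ 1`, `4s₀(l) < ρ`,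
`1000ℓ(2s₀(l)+3R) ≤ 1`): for `2‖y‖ < R`,
`‖f_l(y)(c)‖ ≤ (L + c_R(l))·‖y‖ + D(l,R)·(2dLᵈ)·‖y‖²` — linear part by F-2 ✓`norm_fderiv_chart_le_mul_sup`, quadratic defect by ★routeR-w6 ✓`norm_chart_sub_fderiv_le_localMass_of_plaqSmall`
with `Σ_{Rd(c)}‖y b‖² ≤ #Rd(c)·‖y‖² ≤ 2dLᵈ‖y‖²` (✓`card_nbhd_le`). [cite: Balaban1985Averaging, (121)-(127) p.36, (131) p.37, (139) p.39] -/
theorem norm_chart_apply_le_of_plaqSmall {l : ℕ} (hl : l + 2 ≤ P.m + P.K) (U₀ : GaugeField P 0 (Matrix.specialUnitaryGroup (Fin 2) ℂ))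
    {a₀ : ℝ} (ha₀ : 0 < a₀) (hU : PlaqSmall a₀ U₀)
    (hbud₀ : 6400 * (((P.d + 2) * P.L : ℕ) : ℝ) ^ 2 * (P.L : ℝ) ^ l * (2 * ((P.d : ℝ) * (3 * (P.L : ℝ) ^ (l + 1) - 1)) * a₀) ≤ 1)
    {ρ : ℝ} (hρ0 : 0 < ρ) (hbudget : 10000000 * (((P.d + 2) * P.L : ℕ) : ℝ) ^ 2 * ρ ≤ 1)
    (hs₀ρ : 4 * (30 * (((P.d + 2) * P.L : ℕ) : ℝ) * (P.L : ℝ) ^ l * (2 * ((P.d : ℝ) * (3 * (P.L : ℝ) ^ (l + 1) - 1)) * a₀)) < ρ)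
    {R : ℝ} (hR : 0 < R) (hwin : 1000 * (((P.d + 2) * P.L : ℕ) : ℝ) * (2 * (30 * (((P.d + 2) * P.L : ℕ) : ℝ) * (P.L : ℝ) ^ l * (2 * ((P.d : ℝ) * (3 * (P.L : ℝ) ^ (l + 1) - 1)) * a₀)) + 3 * R) ≤ 1)
    (c : PBond P (l + 1)) {y : PBond P l → Matrix (Fin 2) (Fin 2) ℂ} (hyR : 2 * ‖y‖ < R) :
    ‖mlog (((dbarCovU (emlIterU l (unitsField (toUField U₀))) (fun b => expUnit (y b) * emlIterU l (unitsField (toUField U₀)) b) c :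
            (Matrix (Fin 2) (Fin 2) ℂ)ˣ) : Matrix (Fin 2) (Fin 2) ℂ) *
          (((emlAvgU (emlIterU l (unitsField (toUField U₀))) c)⁻¹ : (Matrix (Fin 2) (Fin 2) ℂ)ˣ) : Matrix (Fin 2) (Fin 2) ℂ))‖ ≤
      ((P.L : ℝ) + (16 * (12 * (P.L : ℝ) * ρ) / ρ ^ 2 * (2 * (30 * (((P.d + 2) * P.L : ℕ) : ℝ) * (P.L : ℝ) ^ l * (2 * ((P.d : ℝ) * (3 * (P.L : ℝ) ^ (l + 1) - 1)) * a₀))))) * ‖y‖ + (80 * ((P.L : ℝ) * (3 * R) + 22100 * (((P.d + 2) * P.L : ℕ) : ℝ) ^ 2 * ((30 * (((P.d + 2) * P.L : ℕ) : ℝ) * (P.L : ℝ) ^ l * (2 * ((P.d : ℝ) * (3 * (P.L : ℝ) ^ (l + 1) - 1)) * a₀)) + ((30 * (((P.d + 2) * P.L : ℕ) : ℝ) * (P.L : ℝ) ^ l * (2 * ((P.d : ℝ) * (3 * (P.L : ℝ) ^ (l + 1) - 1)) * a₀)) + 3 * R)) ^ 2) / R ^ 2) * (2 * P.d * (P.L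 : ℝ) ^ P.d) * ‖y‖ ^ 2 := by
  classical
  have hL1 : (1 : ℝ) ≤ P.L := by exact_mod_cast P.L_pos
  have hs₀0 : 0 ≤ (30 * (((P.d + 2) * P.L : ℕ) : ℝ) * (P.L : ℝ) ^ l * (2 * ((P.d : ℝ) * (3 * (P.L : ℝ) ^ (l + 1) - 1)) * a₀)) := by
    have h3 : (0 : ℝ) ≤ 3 * (P.L : ℝ) ^ (l + 1) - 1 := by linarith [one_le_pow₀ (n := l + 1) hL1]
    have ha := ha₀.le
    positivity
  have hl1 : l + 1 ≤ P.m + P.K := by omega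
  -- the linear part
  have hlin := norm_fderiv_chart_le_mul_sup hl1 c (emlIterU l (unitsField (toUField U₀))) (transfUp (fun x => Unitary.toUnits (suIncl (axialT U₀ (embIter (l + 1) c.src) x)) : GaugeTransf P 0 (Matrix (Fin 2) (Fin 2) ℂ)ˣ) l)
    (fun x => (norm_transfUp_toUnits_le_one _ l x).1) (fun x => (norm_transfUp_toUnits_le_one _ l x).2) hρ0 hbudget hs₀0 hs₀ρ
    (norm_bgTower_gauged_sub_one_le_of_plaqSmall hl U₀ ha₀ hU hbud₀ c) y
  -- the quadratic defect
  have hdef := norm_chart_sub_fderiv_le_localMass_of_plaqSmall hl U₀ ha₀ hU hR (norm_nonneg y) hyR hbud₀ hwin c (y := y)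
    (fun b _ _ => norm_le_pi_norm y b)
  -- the local mass of squares against the sup
  have hmass : ∑ b ∈ (univ.filter fun b : PBond P l =>
        (blockOf b.src = c.src ∨ blockOf b.src = c.tgt) ∧ (blockOf b.tgt = c.src ∨ blockOf b.tgt = c.tgt)), ‖y b‖ ^ 2 ≤
      (2 * P.d * (P.L : ℝ) ^ P.d) * ‖y‖ ^ 2 := by
    have hsub : (univ.filter fun b : PBond P l =>
          (blockOf b.src = c.src ∨ blockOf b.src = c.tgt) ∧ (blockOf b.tgt = c.src ∨ blockOf b.tgt = c.tgt)) ⊆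
        (univ.filter fun b : PBond P l => blockOf b.src = c.src ∨ blockOf b.src = c.tgt) := by
      intro b hb
      rw [Finset.mem_filter] at hb ⊢
      exact ⟨hb.1, hb.2.1⟩
    calc _ ≤ ∑ b ∈ (univ.filter fun b : PBond P l => blockOf b.src = c.src ∨ blockOf b.src = c.tgt), ‖y b‖ ^ 2 :=
          Finset.sum_le_sum_of_subset_of_nonneg hsub fun b _ _ => by positivity
      _ ≤ ∑ b ∈ (univ.filter fun b : PBond P l => blockOf b.src = c.src ∨ blockOf b.src = c.tgt), ‖y‖ ^ 2 :=
          Finset.sum_le_sum fun b _ => by gcongr; exact norm_le_pi_norm y b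
      _ = ((univ.filter fun b : PBond P l => blockOf b.src = c.src ∨ blockOf b.src = c.tgt).card : ℝ) * ‖y‖ ^ 2 := by
          rw [Finset.sum_const, nsmul_eq_mul]
      _ ≤ (2 * P.d * (P.L : ℝ) ^ P.d) * ‖y‖ ^ 2 := mul_le_mul_of_nonneg_right (card_nbhd_le hl1 c) (by positivity)
  have hD0 : 0 ≤ (80 * ((P.L : ℝ) * (3 * R) + 22100 * (((P.d + 2) * P.L : ℕ) : ℝ) ^ 2 * ((30 * (((P.d + 2) * P.L : ℕ) : ℝ) * (P.L : ℝ) ^ l * (2 * ((P.d : ℝ) * (3 * (P.L : ℝ) ^ (l + 1) - 1)) * a₀)) + ((30 * (((P.d + 2) * P.L : ℕ) : ℝ) * (P.L : ℝ) ^ l * (2 * ((P.d : ℝ) * (3 * (P.L : ℝ) ^ (l + 1) - 1)) * a₀)) + 3 * R)) ^ 2) / R ^ 2) := by positivity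
  calc _ = ‖fderiv ℂ (fun y : PBond P l → Matrix (Fin 2) (Fin 2) ℂ => mlog (((dbarCovU (emlIterU l (unitsField (toUField U₀))) (fun b => expUnit (y b) * emlIterU l (unitsField (toUField U₀)) b) c :
            (Matrix (Fin 2) (Fin 2) ℂ)ˣ) : Matrix (Fin 2) (Fin 2) ℂ) *
          (((emlAvgU (emlIterU l (unitsField (toUField U₀))) c)⁻¹ : (Matrix (Fin 2) (Fin 2) ℂ)ˣ) : Matrix (Fin 2) (Fin 2) ℂ))) 0 y + (mlog (((dbarCovU (emlIterU l (unitsField (toUField U₀))) (fun b => expUnit (y b) * emlIterU l (unitsField (toUField U₀)) b) c :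
            (Matrix (Fin 2) (Fin 2) ℂ)ˣ) : Matrix (Fin 2) (Fin 2) ℂ) *
          (((emlAvgU (emlIterU l (unitsField (toUField U₀))) c)⁻¹ : (Matrix (Fin 2) (Fin 2) ℂ)ˣ) : Matrix (Fin 2) (Fin 2) ℂ)) - fderiv ℂ (fun y : PBond P l → Matrix (Fin 2) (Fin 2) ℂ => mlog (((dbarCovU (emlIterU l (unitsField (toUField U₀))) (fun b => expUnit (y b) * emlIterU l (unitsField (toUField U₀)) b) c :
            (Matrix (Fin 2) (Fin 2) ℂ)ˣ) : Matrix (Fin 2) (Fin 2) ℂ) *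
          (((emlAvgU (emlIterU l (unitsField (toUField U₀))) c)⁻¹ : (Matrix (Fin 2) (Fin 2) ℂ)ˣ) : Matrix (Fin 2) (Fin 2) ℂ))) 0 y)‖ := by
        rw [add_sub_cancel]
    _ ≤ _ := norm_add_le _ _
    _ ≤ ((P.L : ℝ) + (16 * (12 * (P.L : ℝ) * ρ) / ρ ^ 2 * (2 * (30 * (((P.d + 2) * P.L : ℕ) : ℝ) * (P.L : ℝ) ^ l * (2 * ((P.d : ℝ) * (3 * (P.L : ℝ) ^ (l + 1) - 1)) * a₀))))) * ‖y‖ + (80 * ((P.L : ℝ) * (3 * R) + 22100 * (((P.d + 2) * P.L : ℕ) : ℝ) ^ 2 * ((30 * (((P.d + 2) * P.L : ℕ) : ℝ) * (P.L : ℝ) ^ l * (2 * ((P.d : ℝ) * (3 * (P.L : ℝ) ^ (l + 1) - 1)) * a₀)) + ((30 * (((P.d + 2) * P.L : ℕ) : ℝ) * (P.L : ℝ) ^ l * (2 * ((P.d : ℝ) * (3 * (P.L : ℝ) ^ (l + 1) - 1)) * a₀)) + 3 * R)) ^ 2) / R ^ 2) * ((2 * P.d * (P.L : ℝ) ^ P.d)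 * ‖y‖ ^ 2) :=
        add_le_add hlin (hdef.trans (mul_le_mul_of_nonneg_left hmass hD0))
    _ = _ := by ring

/-- ★★★ **THE SIZES OF THE ORBIT OF THE COVARIANT LOG-COORDINATE TOWER**: `PlaqSmall a₀ U₀`, `J + 1 ≤ m_P + K_P`, the budgets of `norm_chart_apply_le_of_plaqSmall` at every level
`l < J` (one `ρ`, one `R`), the iterate `Fm` of ✓`Prop7CovLogTower.exists_iterate` (`Fm 0 x = x`, `Fm (l+1) x = f_l(Fm l x)`), `8L^J‖B‖ ≤ R`, and the two DISPLAYED summability windows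
`Σ_{l<J} c_R(l) ≤ L/4`, `Σ_{l<J} D(l,R)·2dLᵈ·(2Lˡ‖B‖) ≤ L/4`.  Then **`‖Fm m B‖ ≤ 2·Lᵐ·‖B‖` for every `m ≤ J`** — the sizes `s_m := 2Lᵐ‖B‖` (`L·s_m = s_{m+1}`) of
✓`ChartKernelTower.kernel_tower_bound_le` at a curved background. [cite: Balaban1985Averaging, (131) p.37, (149)-(150) p.40] -/
theorem norm_iterate_le_of_plaqSmall {J : ℕ} (hJ : J + 1 ≤ P.m + P.K) (U₀ : GaugeField P 0 (Matrix.specialUnitaryGroup (Fin 2) ℂ))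
    {a₀ : ℝ} (ha₀ : 0 < a₀) (hU : PlaqSmall a₀ U₀)
    (hbud₀ : ∀ l, l < J → 6400 * (((P.d + 2) * P.L : ℕ) : ℝ) ^ 2 * (P.L : ℝ) ^ l * (2 * ((P.d : ℝ) * (3 * (P.L : ℝ) ^ (l + 1) - 1)) * a₀) ≤ 1)
    {ρ : ℝ} (hρ0 : 0 < ρ) (hbudget : 10000000 * (((P.d + 2) * P.L : ℕ) : ℝ) ^ 2 * ρ ≤ 1)
    (hs₀ρ : ∀ l, l < J → 4 * (30 * (((P.d + 2) * P.L : ℕ) : ℝ) * (P.L : ℝ) ^ l * (2 * ((P.d : ℝ) * (3 * (P.L : ℝ) ^ (l + 1) - 1)) * a₀)) < ρ)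
    {R : ℝ} (hR : 0 < R) (hwin : ∀ l, l < J → 1000 * (((P.d + 2) * P.L : ℕ) : ℝ) * (2 * (30 * (((P.d + 2) * P.L : ℕ) : ℝ) * (P.L : ℝ) ^ l * (2 * ((P.d : ℝ) * (3 * (P.L : ℝ) ^ (l + 1) - 1)) * a₀)) + 3 * R) ≤ 1)
    (Fm : (m : ℕ) → (PBond P 0 → Matrix (Fin 2) (Fin 2) ℂ) → (PBond P m → Matrix (Fin 2) (Fin 2) ℂ)) (hF0 : ∀ x, Fm 0 x = x)
    (hFs : ∀ (l : ℕ) (x : PBond P 0 → Matrix (Fin 2) (Fin 2) ℂ), Fm (l + 1) x =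
      (fun (y : PBond P l → Matrix (Fin 2) (Fin 2) ℂ) (c : PBond P (l + 1)) => mlog (((dbarCovU (emlIterU l (unitsField (toUField U₀))) (fun b => expUnit (y b) * emlIterU l (unitsField (toUField U₀)) b) c :
            (Matrix (Fin 2) (Fin 2) ℂ)ˣ) : Matrix (Fin 2) (Fin 2) ℂ) *
          (((emlAvgU (emlIterU l (unitsField (toUField U₀))) c)⁻¹ : (Matrix (Fin 2) (Fin 2) ℂ)ˣ) : Matrix (Fin 2) (Fin 2) ℂ))) (Fm l x))
    (B : PBond P 0 → Matrix (Fin 2) (Fin 2) ℂ) (hB : 8 * (P.L : ℝ) ^ J * ‖B‖ ≤ R)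
    (hsumR : ∑ l ∈ Finset.range J, (16 * (12 * (P.L : ℝ) * ρ) / ρ ^ 2 * (2 * (30 * (((P.d + 2) * P.L : ℕ) : ℝ) * (P.L : ℝ) ^ l * (2 * ((P.d : ℝ) * (3 * (P.L : ℝ) ^ (l + 1) - 1)) * a₀)))) ≤ (P.L : ℝ) / 4)
    (hsumD : ∑ l ∈ Finset.range J, (80 * ((P.L : ℝ) * (3 * R) + 22100 * (((P.d + 2) * P.L : ℕ) : ℝ) ^ 2 * ((30 * (((P.d + 2) * P.L : ℕ) : ℝ) * (P.L : ℝ) ^ l * (2 * ((P.d : ℝ) * (3 * (P.L : ℝ) ^ (l + 1) - 1)) * a₀)) + ((30 * (((P.d + 2) * P.L : ℕ) : ℝ) * (P.L : ℝ) ^ l * (2 * ((P.d : ℝ) * (3 * (P.L : ℝ) ^ (l + 1) - 1)) * a₀)) + 3 * R)) ^ 2) / R ^ 2) * (2 * P.d * (P.L : ℝ) ^ P.d) * (2 * (P.L : ℝ) ^ l * ‖B‖) ≤ (P.L : ℝ) / 4) :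
    ∀ m, m ≤ J → ‖Fm m B‖ ≤ 2 * (P.L : ℝ) ^ m * ‖B‖ := by
  have hL1 : (1 : ℝ) ≤ P.L := by exact_mod_cast P.L_pos
  have hLpos : (0 : ℝ) < P.L := by linarith
  have hs₀0 : ∀ l, 0 ≤ (30 * (((P.d + 2) * P.L : ℕ) : ℝ) * (P.L : ℝ) ^ l * (2 * ((P.d : ℝ) * (3 * (P.L : ℝ) ^ (l + 1) - 1)) * a₀)) := by
    intro l
    have h3 : (0 : ℝ) ≤ 3 * (P.L : ℝ) ^ (l + 1) - 1 := by linarith [one_le_pow₀ (n := l + 1) hL1]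
    have ha := ha₀.le
    positivity
  refine orbit_growth_le J (fun m => ‖Fm m B‖) (fun l => (16 * (12 * (P.L : ℝ) * ρ) / ρ ^ 2 * (2 * (30 * (((P.d + 2) * P.L : ℕ) : ℝ) * (P.L : ℝ) ^ l * (2 * ((P.d : ℝ) * (3 * (P.L : ℝ) ^ (l + 1) - 1)) * a₀))))) (fun l => (80 * ((P.L : ℝ) * (3 * R) + 22100 * (((P.d + 2) * P.L : ℕ) : ℝ) ^ 2 * ((30 * (((P.d + 2) * P.L : ℕ) : ℝ) * (P.L : ℝ) ^ l * (2 * ((P.d : ℝ) * (3 * (P.L : ℝ) ^ (l + 1) - 1)) * a₀)) + ((30 * (((P.d + 2) * P.L : ℕ) : ℝ) * (P.L : ℝ) ^ l * (2 * ((P.d : ℝ) * (3 * (P.L : ℝ) ^ (l + 1) - 1)) * a₀)) + 3 * R)) ^ 2) / R ^ 2) * (2 * P.d * (P.L : ℝ) ^ P.d))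
    (σ := R / 4) hLpos (norm_nonneg B) (fun l _ => by have := hs₀0 l; positivity) (fun l _ => by have := hs₀0 l; positivity)
    (fun m _ => norm_nonneg _) (by rw [hF0]) ?_ ?_ ?_
  · -- the one-step growth, sup over the coarse bonds
    intro l hl hσ
    have hl2 : l + 2 ≤ P.m + P.K := by omega
    have hyR : 2 * ‖Fm l B‖ < R := by linarith
    have hnn : 0 ≤ ((P.L : ℝ) + (16 * (12 * (P.L : ℝ) * ρ) / ρ ^ 2 * (2 * (30 * (((P.d + 2) * P.L : ℕ) : ℝ) * (P.L : ℝ) ^ l * (2 * ((P.d : ℝ) * (3 * (P.L : ℝ) ^ (l + 1) - 1)) * a₀)))) + (80 * ((P.L : ℝ) * (3 * R) + 22100 * (((P.d + 2) * P.L : ℕ) : ℝ) ^ 2 * ((30 * (((P.d + 2) * P.L : ℕ) : ℝ) * (P.L : ℝ) ^ l * (2 * ((P.d : ℝ) * (3 * (P.L : ℝ) ^ (l + 1) - 1)) * a₀)) + ((30 * (((P.d + 2) * P.L : ℕ) : ℝ) * (P.L : ℝ) ^ l * (2 * ((P.d : ℝ) * (3 * (P.L : ℝ) ^ (l + 1)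 - 1)) * a₀)) + 3 * R)) ^ 2) / R ^ 2) * (2 * P.d * (P.L : ℝ) ^ P.d) * ‖Fm l B‖) * ‖Fm l B‖ := by
      have := hs₀0 l; positivity
    rw [hFs l B]
    refine (pi_norm_le_iff_of_nonneg hnn).2 fun c => ?_
    have h := norm_chart_apply_le_of_plaqSmall hl2 U₀ ha₀ hU (hbud₀ l hl) hρ0 hbudget (hs₀ρ l hl) hR (hwin l hl) c hyR
    refine h.trans (le_of_eq ?_)
    ring
  · -- the domain condition
    intro m hm
    have hpow : (P.L : ℝ) ^ m ≤ (P.L : ℝ) ^ J := pow_le_pow_right₀ hL1 hm.le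
    have : 2 * (P.L : ℝ) ^ m * ‖B‖ ≤ 2 * (P.L : ℝ) ^ J * ‖B‖ := by gcongr
    linarith
  · -- summability
    rw [Finset.sum_add_distrib]
    linarith

end SU2

end Summit.QuantumFields.YangMills.Theorems.Prop7CovOrbitSizes

end
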